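import Summits.CriticalPhenomena.PercolationContinuityZ3.Theses.PercShatteringRace
import Summits.CriticalPhenomena.PercolationContinuityZ3.Theorems.PercShatteringRaceNearLinearTwoClusterDecayStubPeelInclusion
import Literature.Probability.Percolation.SharpnessDCTProofs

/-!
# Crux `PercShatteringRace.NearLinearTwoClusterDecay` (stmt-CriticalPhenomena-5785), line `shell-product-kiss-positivity` — stub `stub_shellEncoding`

Helper file for the lead's skeleton of line `shell-product-kiss-positivity`
(`Cruxes/NearLinearTwoClusterDecay/Lines/shell_product_kiss_positivity.lean`, skeleton rev L1-c1,
prover-line-stmt-CriticalPhenomena-5785-c1-0). Proves exactly the registered stub signature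
`stub_shellEncoding`; lands with `--supports stmt-CriticalPhenomena-5785`.

## The statement (a dictionary, deterministic)

Write `Λ(k) = box 3 k`, `∂ⁱⁿΛ(k) = innerBoundary (zdGraph 3) (box 3 k)` and
`{x ⟷ y in S} = openConnIn S x y`. The landed OPEN-SHELL two-cluster event `Sh(N, R)` of
`Theorems/PercShatteringRaceNearLinearTwoClusterDecayOf[Sparse]ShellNonCertainty.lean` — two
sources `u, u'` in the layer `Λ(N+1) ∖ Λ(N)`, each joined inside the open shell `Λ(R) ∖ Λ(N)` to
`∂ⁱⁿΛ(R)`, not joined to each other inside that shell — produces two points `x 0, x 1` of the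
sphere `∂ⁱⁿΛ(N+1)`, each joined inside the CLOSED shell
`S(N+1, R) = Λ(R) ∖ (Λ(N+1) ∖ ∂ⁱⁿΛ(N+1)) = {N+1 ≤ ‖v‖∞ ≤ R}` to `∂ⁱⁿΛ(R)` and pairwise not
joined inside `S(N+1, R)` (the line's `{N(N+1, R) ≥ 2}` spelled out).

## The argument

The two vertex sets coincide:
`Λ(R) ∖ Λ(N) = Λ(R) ∖ (Λ(N+1) ∖ ∂ⁱⁿΛ(N+1))` (`NearLinearTwoClusterDecayShellEnc.coe_box_sdiff_eq`),
because `Λ(N) = Λ(N+1) ∖ ∂ⁱⁿΛ(N+1)`: a site of `Λ(N)` is not on `∂ⁱⁿΛ(N+1)`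
(`DCT16.notMem_box_of_mem_innerBoundary_box`), and a site of `Λ(N+1) ∖ Λ(N)` has a coordinate of
absolute value `N+1`, hence lies on `∂ⁱⁿΛ(N+1)` (`DCT16.mem_innerBoundary_box_of_natAbs_eq`: move
that coordinate outwards). After rewriting the three connection events along this set identity
they are literally the hypothesis events; take `x = ![u, u']`; the pair `(1, 0)` is the pair
`(0, 1)` by symmetry of `{x ⟷ y in S}` (`DCT16.mem_openConnIn_iff_pathIn`, `PathIn.symm`).

Tree API used: `mem_box`, `box_mono`, `DCT16.notMem_box_of_mem_innerBoundary_box`,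
`DCT16.mem_innerBoundary_box_of_natAbs_eq`, `DCT16.mem_openConnIn_iff_pathIn`, `PathIn.symm`.
No new definitions, no named facts.
-/

noncomputable section

open Literature.Probability.Percolation Literature.Probability.LatticeModels

namespace Summit.CriticalPhenomena.PercolationContinuityZ3.Theorems

namespace NearLinearTwoClusterDecayShellEnc

/-- A site of the layer `Λ(N+1) ∖ Λ(N)` lies on the sphere `∂ⁱⁿΛ(N+1)`: some coordinate has
absolute value `N+1`; move it outwards. [folklore] -/
theorem mem_innerBoundary_of_mem_layer {N : ℕ} {x : Site 3} (hx : x ∈ box 3 (N + 1))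
    (hxN : x ∉ box 3 N) : x ∈ innerBoundary (zdGraph 3) (box 3 (N + 1)) := by
  rw [mem_box, not_forall] at hxN
  obtain ⟨i, hi⟩ := hxN
  have hxi := (mem_box.1 hx) i
  refine DCT16.mem_innerBoundary_box_of_natAbs_eq hx (i := i) ?_
  push_cast at hxi
  omega

/-- `Λ(N) = Λ(N+1) ∖ ∂ⁱⁿΛ(N+1)` pointwise: a site lies in `Λ(N)` iff it lies in `Λ(N+1)` but not on
the sphere `∂ⁱⁿΛ(N+1)`. [folklore] -/
theorem mem_box_iff_mem_box_succ_and_notMem_innerBoundary {N : ℕ} {x : Site 3} :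
    x ∈ box 3 N ↔ x ∈ box 3 (N + 1) ∧ x ∉ innerBoundary (zdGraph 3) (box 3 (N + 1)) := by
  constructor
  · intro hxN
    exact ⟨box_mono 3 (Nat.le_succ N) hxN,
      fun h => DCT16.notMem_box_of_mem_innerBoundary_box (Nat.lt_succ_self N) h hxN⟩
  · rintro ⟨hx1, hxb⟩
    by_contra hxN
    exact hxb (mem_innerBoundary_of_mem_layer hx1 hxN)

/-- **The open shell above `Λ(N)` is the closed shell `S(N+1, R)`** as a set of sites:
`Λ(R) ∖ Λ(N) = Λ(R) ∖ (Λ(N+1) ∖ ∂ⁱⁿΛ(N+1)) = {N+1 ≤ ‖v‖∞ ≤ R}`. [folklore] -/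
theorem coe_box_sdiff_eq (N R : ℕ) :
    (↑(box 3 R) : Set (Site 3)) \ ↑(box 3 N) =
      (↑(box 3 R) : Set (Site 3)) \
        ((↑(box 3 (N + 1)) : Set (Site 3)) \ ↑(innerBoundary (zdGraph 3) (box 3 (N + 1)))) := by
  ext x
  simp only [Set.mem_sdiff, Finset.mem_coe]
  exact and_congr_right fun _ => not_congr mem_box_iff_mem_box_succ_and_notMem_innerBoundary

/-- A layer point `u ∈ Λ(N+1) ∖ Λ(N)` (sets of sites) lies on `∂ⁱⁿΛ(N+1)`. [folklore] -/
theorem mem_innerBoundary_of_mem_coe_layer {N : ℕ} {u : Site 3}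
    (hu : u ∈ (↑(box 3 (N + 1)) : Set (Site 3)) \ ↑(box 3 N)) :
    u ∈ innerBoundary (zdGraph 3) (box 3 (N + 1)) :=
  mem_innerBoundary_of_mem_layer (Finset.mem_coe.1 hu.1) fun h => hu.2 (Finset.mem_coe.2 h)

end NearLinearTwoClusterDecayShellEnc

/-- **Registered stub `stub_shellEncoding`** of line `shell-product-kiss-positivity` (crux
`NearLinearTwoClusterDecay`, stmt-CriticalPhenomena-5785): the landed open-shell two-cluster event
`Sh(N, R)` (sources in the layer `Λ(N+1) ∖ Λ(N)`, connections inside `Λ(R) ∖ Λ(N)`) yields two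
points of the sphere `∂ⁱⁿΛ(N+1)`, each joined inside the closed shell
`S(N+1, R) = Λ(R) ∖ (Λ(N+1) ∖ ∂ⁱⁿΛ(N+1))` to `∂ⁱⁿΛ(R)` and pairwise not joined inside `S(N+1, R)`.
Proof: the two shells are the same set of sites (`NearLinearTwoClusterDecayShellEnc.coe_box_sdiff_eq`),
layer points lie on `∂ⁱⁿΛ(N+1)`, `x = ![u, u']`, and the pair `(1, 0)` follows from `(0, 1)` by
symmetry of `openConnIn`. [folklore] -/
theorem stub_shellEncoding :
    ∀ (N R : ℕ) (ω : BondConfig (Site 3)),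
      (∃ u ∈ (↑(box 3 (N + 1)) : Set (Site 3)) \ ↑(box 3 N),
        ∃ u' ∈ (↑(box 3 (N + 1)) : Set (Site 3)) \ ↑(box 3 N),
        ∃ v ∈ innerBoundary (zdGraph 3) (box 3 R), ∃ v' ∈ innerBoundary (zdGraph 3) (box 3 R),
          ω ∈ openConnIn ((↑(box 3 R) : Set (Site 3)) \ ↑(box 3 N)) u v ∧
          ω ∈ openConnIn ((↑(box 3 R) : Set (Site 3)) \ ↑(box 3 N)) u' v' ∧
          ω ∉ openConnIn ((↑(box 3 R) : Set (Site 3)) \ ↑(box 3 N)) u u') →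
      ∃ x : Fin 2 → Site 3,
        (∀ i, x i ∈ innerBoundary (zdGraph 3) (box 3 (N + 1)) ∧
          ∃ y ∈ innerBoundary (zdGraph 3) (box 3 R),
            ω ∈ openConnIn ((↑(box 3 R) : Set (Site 3)) \
              ((↑(box 3 (N + 1)) : Set (Site 3)) \ ↑(innerBoundary (zdGraph 3) (box 3 (N + 1))))) (x i) y) ∧
        ∀ i j, i ≠ j → ω ∉ openConnIn ((↑(box 3 R) : Set (Site 3)) \
          ((↑(box 3 (N + 1)) : Set (Site 3)) \ ↑(innerBoundary (zdGraph 3) (box 3 (N + 1))))) (x i) (x j) := by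
  intro N R ω h
  obtain ⟨u, hu, u', hu', v, hv, v', hv', huv, hu'v', huu'⟩ := h
  rw [NearLinearTwoClusterDecayShellEnc.coe_box_sdiff_eq N R] at huv hu'v' huu'
  have huB := NearLinearTwoClusterDecayShellEnc.mem_innerBoundary_of_mem_coe_layer hu
  have hu'B := NearLinearTwoClusterDecayShellEnc.mem_innerBoundary_of_mem_coe_layer hu'
  refine ⟨![u, u'], ?_, ?_⟩
  · intro i
    fin_cases i
    · exact ⟨huB, v, hv, huv⟩
    · exact ⟨hu'B, v', hv', hu'v'⟩
  · intro i j hij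
    fin_cases i <;> fin_cases j
    · exact absurd rfl hij
    · exact huu'
    · -- the pair `(1, 0)`: reverse an open path `u' ⟷ u` inside the shell
      exact fun h => huu'
        (DCT16.mem_openConnIn_iff_pathIn.2 (DCT16.mem_openConnIn_iff_pathIn.1 h).symm)
    · exact absurd rfl hij

end Summit.CriticalPhenomena.PercolationContinuityZ3.Theorems

end
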